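import Literature.Probability.LatticeModels.FKIsingTopologicalRectangleCrossing
import HarnessLib

/-!
# Discrete extremal length between EXTERNAL boundary arcs of a discrete topological rectangle:
# the sandwich with the inner arcs and the self-duality (Chelkak–Duminil-Copin–Hongler 2016, §3.3)

Topic `Literature/Probability/LatticeModels` (family `crit-ising`); companion of
`FKIsingTopologicalRectangleCrossing.lean` (discrete topological rectangles `DiscreteRect.IsRect E d₀ n` of
`ℤ²` presented by an edge set, a first external dart and the sizes of the four arcs; CDH16 Thm 1.1 as the
named fact `fkIsing_topologicalRectangle_crossingBounds`, stated with the resistance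
`ℓ_Ω[(ab),(cd)]` between the INNER arcs `arcVerts 0`, `arcVerts 2`). D. Chelkak, H. Duminil-Copin,
C. Hongler, *Crossing probabilities in topological rectangles for the critical planar FK-Ising model*,
Electron. J. Probab. 21 (2016), no. 5 = arXiv:1312.7785, §3.3 (held text, `lit read arxiv:1312.7785`,
p. 10 of the rendering) work in parallel with the completed graph `Ω̄ = Ω ∪ ∂_ext Ω`: "Given `x ∈ ∂Ω`, let
`x_ext ∈ ∂_ext Ω` be the corresponding external vertex … `x x_ext ∈ 𝓔_ext(Ω)` and, by definition, this
is the only edge of `Ω̄` incident to `x_ext`" — every external dart `(x, k)` (missing lattice edge at a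
boundary vertex) carries its own formal external vertex of degree one, joined to `x` by one unit edge
(the half-edge convention of D. Chelkak, *Robust discrete complex analysis: a toolbox*, Ann. Probab. 44
(2016), §2.1) — and "let `ℓ_Ω̄[(a_ext b_ext),(c_ext d_ext)]` denote the resistance between the
corresponding external boundary arcs in `Ω̄`". They record (first and third displayed properties of
§3.3, proved from Chelkak 2016, Prop. 6.2 and Cor. 6.3: "both extremal lengths are uniformly comparable
to their continuous counterparts", "the exact duality of continuous extremal lengths"):

* `ℓ_Ω[(ab),(cd)] ≤ ℓ_Ω̄[(a_ext b_ext),(c_ext d_ext)] ≤ ℓ_Ω[(ab),(cd)] + 4(2√2 - 1)`;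
* "discrete extremal lengths satisfy the following self-duality property:
  `ℓ_Ω̄[(a_ext b_ext),(c_ext d_ext)] · ℓ_Ω̄[(b_ext c_ext),(d_ext a_ext)] ≍ 1`,
  where the constants in `≍` do not depend on `(Ω, a, b, c, d)`."

This file TYPES the completed graph on the vertex type `Site 2 ⊕ (Site 2 × Fin 4)` (lattice vertices,
and one formal external vertex `inr (x, k)` per external dart), the external arcs (the external vertices
of the darts of the `j`-th arc of the presentation `(E, d₀, n)`), the resistance between two external arcs
(`DiscreteRect.extResistance`, the tree's `effectiveResistance` with unit conductances = Duffin's discrete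
extremal length, `extremalLength_eq_effectiveResistance`), and vendors the two displayed properties as
NAMED FACTS (`Prop`s, nothing asserted): `discreteEL_ext_sandwich`, `discreteEL_ext_selfDual`. They are the
inputs through which Thm 1.1 (ii) (hypothesis `ℓ_Ω[(ab),(cd)] ≥ L⁻¹` on the inner arcs) is applied to the
rim-to-rim crossings of lattice conformal annuli, exactly as in CDH16's own proof of Thm 1.1 (ii) (p. 14:
"`ℓ_{Ω*}[(b*c*),(d*a*)] ≍ ℓ_Ω̄[(b_ext c_ext),(d_ext a_ext)] ≲ (ℓ_Ω[(ab),(cd)])⁻¹`").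

## References
* [ChelkakDuminilCopinHongler2016] D. Chelkak, H. Duminil-Copin, C. Hongler, EJP 21 (2016) no. 5, §3.3
  (displayed properties of the discrete extremal length), and the proof of Thm 1.1 (ii), §4.
* [Chelkak2016] D. Chelkak, *Robust discrete complex analysis: a toolbox*, Ann. Probab. 44 (2016),
  §2.1 (boundary half-edges), Prop. 6.2, Cor. 6.3.
* [Duffin1962] R. J. Duffin, *The extremal length of a network*, J. Math. Anal. Appl. 5 (1962).
-/

noncomputable section

open scoped ENNReal NNReal

namespace Literature.Probability.LatticeModels

namespace DiscreteRect

/-- **The completed graph `Ω̄ = Ω ∪ ∂_ext Ω`** of the discrete domain with edge set `E`, on the vertex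
type `Site 2 ⊕ (Site 2 × Fin 4)`: the edges of `E` between lattice vertices `inl x`, and for every
external dart `d = (x, k)` of `E` one unit edge from `inl x` to its own formal external vertex `inr d`
("by definition, this is the only edge of `Ω̄` incident to `x_ext`").
[cite: ChelkakDuminilCopinHongler2016, §3.3] -/
def extGraph (E : Finset (Sym2 (Site 2))) : SimpleGraph (Site 2 ⊕ (Site 2 × Fin 4)) :=
  SimpleGraph.fromRel fun u v =>
    match u, v with
    | .inl x, .inl y => s(x, y) ∈ E
    | .inl x, .inr d => IsExtDart E d ∧ d.1 = x
    | .inr d, .inl x => IsExtDart E d ∧ d.1 = x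
    | .inr _, .inr _ => False

/-- **The `j`-th external arc** `(a_ext b_ext), (b_ext c_ext), (c_ext d_ext), (d_ext a_ext)` (`j = 0, 1, 2, 3`)
of the rectangle `(E, d₀, n)`: the external vertices of the darts at positions `[lo n j, lo n j + n j)` of
the boundary cycle (companion of `arcVerts`, the lattice vertices carrying those darts).
[cite: ChelkakDuminilCopinHongler2016, §3.3] -/
def extArc (E : Finset (Sym2 (Site 2))) (d₀ : Site 2 × Fin 4) (n : Fin 4 → ℕ) (j : Fin 4) :
    Set (Site 2 ⊕ (Site 2 × Fin 4)) :=
  {v | ∃ i, lo n j ≤ i ∧ i < lo n j + n j ∧ v = .inr ((succ E)^[i] d₀)}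

/-- **`ℓ_Ω̄` between two external arcs**: the effective resistance with unit conductances (= the
discrete extremal length, `extremalLength_eq_effectiveResistance`) of the completed graph `Ω̄` between
the external arcs `j` and `j'` of the rectangle `(E, d₀, n)`; `extResistance E d₀ n 0 2` is CDH16's
`ℓ_Ω̄[(a_ext b_ext),(c_ext d_ext)]` and `extResistance E d₀ n 1 3` is `ℓ_Ω̄[(b_ext c_ext),(d_ext a_ext)]`.
[cite: ChelkakDuminilCopinHongler2016, §3.3] -/
def extResistance (E : Finset (Sym2 (Site 2))) (d₀ : Site 2 × Fin 4) (n : Fin 4 → ℕ) (j j' : Fin 4) :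
    ℝ≥0∞ :=
  effectiveResistance (extGraph E) 1 (extArc E d₀ n j) (extArc E d₀ n j')

end DiscreteRect

/-- **Inner and external arcs give the same extremal length up to an absolute additive constant**
(Chelkak–Duminil-Copin–Hongler 2016, §3.3, first displayed property): for every discrete topological
rectangle `(Ω; a, b, c, d)`,
`ℓ_Ω[(ab),(cd)] ≤ ℓ_Ω̄[(a_ext b_ext),(c_ext d_ext)] ≤ ℓ_Ω[(ab),(cd)] + 4(2√2 - 1)`,
here for presentations `DiscreteRect.IsRect E d₀ n`, with `ℓ_Ω[(ab),(cd)]` the unit-conductance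
resistance of `⟨E⟩` between `arcVerts 0` and `arcVerts 2` (as in
`fkIsing_topologicalRectangle_crossingBounds`) and `ℓ_Ω̄` = `DiscreteRect.extResistance E d₀ n 0 2`.
Named fact, not proved here. [cite: ChelkakDuminilCopinHongler2016, §3.3 (first displayed property)] -/
def discreteEL_ext_sandwich : Prop :=
  ∀ (E : Finset (Sym2 (Site 2))) (d₀ : Site 2 × Fin 4) (n : Fin 4 → ℕ), DiscreteRect.IsRect E d₀ n →
    let ℓ : ℝ≥0∞ := effectiveResistance (SimpleGraph.fromEdgeSet (↑E : Set (Sym2 (Site 2)))) 1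
      (DiscreteRect.arcVerts E d₀ n 0) (DiscreteRect.arcVerts E d₀ n 2)
    ℓ ≤ DiscreteRect.extResistance E d₀ n 0 2 ∧
      DiscreteRect.extResistance E d₀ n 0 2 ≤ ℓ + ENNReal.ofReal (4 * (2 * Real.sqrt 2 - 1))

/-- **Self-duality of discrete extremal lengths** (Chelkak–Duminil-Copin–Hongler 2016, §3.3, third
displayed property; from Chelkak 2016, Prop. 6.2 and Cor. 6.3 — comparison with the continuous extremal
lengths of the polygonal representation, which are exact inverses of each other): there is an absolute
constant `C ≥ 1` such that for every discrete topological rectangle `(Ω; a, b, c, d)`,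
`C⁻¹ ≤ ℓ_Ω̄[(a_ext b_ext),(c_ext d_ext)] · ℓ_Ω̄[(b_ext c_ext),(d_ext a_ext)] ≤ C`; here for
presentations `DiscreteRect.IsRect E d₀ n` and `ℓ_Ω̄ = DiscreteRect.extResistance`. Named fact, not proved
here. [cite: ChelkakDuminilCopinHongler2016, §3.3 (self-duality of discrete extremal lengths)] -/
def discreteEL_ext_selfDual : Prop :=
  ∃ C : ℝ, 1 ≤ C ∧
    ∀ (E : Finset (Sym2 (Site 2))) (d₀ : Site 2 × Fin 4) (n : Fin 4 → ℕ), DiscreteRect.IsRect E d₀ n →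
      ENNReal.ofReal C⁻¹ ≤ DiscreteRect.extResistance E d₀ n 0 2 * DiscreteRect.extResistance E d₀ n 1 3 ∧
        DiscreteRect.extResistance E d₀ n 0 2 * DiscreteRect.extResistance E d₀ n 1 3 ≤ ENNReal.ofReal C

end Literature.Probability.LatticeModels

end
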